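import Mathlib.MeasureTheory.Function.LpSeminorm.Basic
import Literature.Analysis.FluidPDE.NormalisedPressure
import HarnessLib

/-!
# The `L^p` bound for the normalised pressure, `1 < p < ∞` (Stein): named fact

Analysis/FluidPDE fact file on the decomposition path of the named fact
`Literature.Analysis.FluidPDE.tsai1998_lemma32` (`FluidPDE/TsaiGrowthLemmas`; T.-P. Tsai, *On
Leray's self-similar solutions of the Navier–Stokes equations satisfying local energy
estimates*, Arch. Rational Mech. Anal. 143 (1998) 29–51, **Lemma 3.2**). Tsai's control of the
pressure (Lemma 2.1, (2.2)–(2.3), p. 34: `P̃ = RᵢRⱼ(UᵢUⱼ)`, `‖P̃‖_{q/2} ≤ C ‖U‖²_q` for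
`2 < q < ∞`, "Estimate (2.3) now follows from [CZ]") rests on the `L^p` boundedness of the
singular integrals `RᵢRⱼ`, i.e. on Stein, *Singular integrals* (1970), Ch. II §4.2, Theorem 3:
for `Ω` homogeneous of degree `0` with mean zero on `S^{n-1}` and Dini-continuous, the truncated
operators `T_ε f(x) = ∫_{|y|≥ε} Ω(y)|y|⁻ⁿ f(x−y) dy` are bounded on `L^p(ℝⁿ)`, `1 < p < ∞`,
uniformly in `ε`, and converge in `L^p` (and a.e., Thm 4) to `T f` with `‖T f‖_p ≤ A_p ‖f‖_p`.

The tree realises `-Σᵢⱼ RᵢRⱼ(wᵢwⱼ)` as the **normalised pressure** `normalisedPressure w`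
(`FluidPDE/NormalisedPressure`; Tao 2011, (35)):
`p̃[w](x) = -|w(x)|²/3 + p.v.∫ K(x−y)(w(y)) dy` with the nine Riesz-type kernels
`Kᵢⱼ(z) = (3zᵢzⱼ − δᵢⱼ|z|²)/(4π|z|⁵) = Ωᵢⱼ(z/|z|)/|z|³`, `Ωᵢⱼ` smooth on `S²` with mean zero. The
case `p = 2` of the resulting bound, `‖p̃[w]‖_{L²} ≤ C ‖|w|²‖_{L²}` for `w ∈ C^∞_c(ℝ³; ℝ³)`, was
vendored as the named fact `Literature.Analysis.FluidPDE.stein1970_normalisedPressure_eLpNorm_le`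
(`FluidPDE/TaoEnergyLocalisationPressure`) and has since been **proved**
(`stein1970_normalisedPressure_eLpNorm_le_holds`, `FluidPDE/NormalisedPressureL2Bound`, by the
Newtonian-potential route and the Hessian–Laplacian identity, sharp for `p = 2`). This file
vendors the same statement for general `1 < p < ∞`,
`Literature.Analysis.FluidPDE.stein1970_normalisedPressure_Lp_bound`, which is what Tsai's
Lemma 2.1 uses with `p = q/2 ∈ [3/2, 2)` when `U ∈ L^q`, `3 ≤ q < 4` (for `q ≥ 4` the proved
`L²` bound suffices in the local form of the argument). Its proof for `p ≠ 2` is genuine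
Calderón–Zygmund theory (weak `(1,1)` bound via the Calderón–Zygmund decomposition, Marcinkiewicz
interpolation, duality), which Mathlib does not have at this pin; nothing is asserted.

## Rendering (design notes)

* As for `p = 2`: the class is `w ∈ C^∞_c(ℝ³; ℝ³)` (then `wᵢwⱼ ∈ L^p` for every `p`, the
  principal value exists at every point and `p̃[w]` is a genuine function,
  `hasPressurePV_of_hasCompactSupport` in `NormalisedPressureL2Bound`), and the bound is on
  `eLpNorm (normalisedPressure w) p volume` by `eLpNorm (|w|²) p volume`; the constant depends on
  `p` only (`C = 1/3 + 9A_p` from Stein's `A_p`). Stein's theorem covers every `f = wᵢwⱼ ∈ L^p`;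
  the compactly supported smooth class is a special case, so the fact is implied by the printed
  theorem.
* The exponent is `p : ℝ≥0∞` with `1 < p < ∞`, matching `eLpNorm`.

## References

* E. M. Stein, *Singular integrals and differentiability properties of functions*, Princeton
  Math. Series 30 (1970): Ch. II §4.2, Theorem 3 (p. 39); Ch. III §1.2 (the Riesz transforms) and
  §1.3, Proposition 3 (p. 59: `‖∂ⱼ∂ₖ f‖_p ≤ A_p ‖Δf‖_p`, `∂ⱼ∂ₖ f = −RⱼRₖΔf`) [Stein1971].
* A. P. Calderón, A. Zygmund, *On the existence of certain singular integrals*, Acta Math. 88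
  (1952) 85–139 (Tsai's [CZ]).
* T.-P. Tsai, *On Leray's self-similar solutions of the Navier–Stokes equations satisfying local
  energy estimates*, Arch. Rational Mech. Anal. 143 (1998), Lemma 2.1, (2.2)–(2.3), p. 34
  [Tsai1998].
* T. Tao, *Localisation and compactness properties of the Navier–Stokes global regularity
  problem*, Anal. PDE 6 (2013) = arXiv:1108.1165, (35) (the normalised pressure) [Tao2011].
-/

noncomputable section

open MeasureTheory
open scoped ENNReal NNReal ContDiff

namespace Literature.Analysis.FluidPDE

/-- Local notation for physical space `ℝ³ = EuclideanSpace ℝ (Fin 3)`. -/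
local notation "ℝ³" => EuclideanSpace ℝ (Fin 3)

/-- **Stein 1970, Ch. II §4.2 Theorem 3, for the Riesz-type kernels of the normalised pressure,
general exponent.** For every `1 < p < ∞` there is a constant `C = C(p)` such that for every
`w ∈ C^∞_c(ℝ³; ℝ³)` the normalised pressure `p̃[w] = -Σᵢⱼ RᵢRⱼ(wᵢwⱼ) = -|w|²/3 + p.v. K * (w ⊗ w)`
(`normalisedPressure w`, Tao 2011 (35)) satisfies `‖p̃[w]‖_{L^p} ≤ C ‖|w|²‖_{L^p}`. (Each of the
nine kernels `Kᵢⱼ(z) = (3zᵢzⱼ − δᵢⱼ|z|²)/(4π|z|⁵)` is `Ω/|z|³` with `Ω` smooth of mean zero on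
`S²`, so Stein's theorem gives `‖p.v. Kᵢⱼ * (wᵢwⱼ)‖_p ≤ A_p ‖wᵢwⱼ‖_p ≤ A_p ‖|w|²‖_p`; this is
Tsai 1998, (2.3).) The case `p = 2` is the tree's `stein1970_normalisedPressure_eLpNorm_le`,
proved in `NormalisedPressureL2Bound`; for `p ≠ 2` this is Calderón–Zygmund theory, absent from
Mathlib. Named fact, nothing asserted. [cite: Stein1971, Ch. II §4.2 Thm 3] -/
def stein1970_normalisedPressure_Lp_bound : Prop :=
  ∀ p : ℝ≥0∞, 1 < p → p < ⊤ →
    ∃ C : ℝ≥0, ∀ w : ℝ³ → ℝ³, ContDiff ℝ ∞ w → HasCompactSupport w →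
      eLpNorm (normalisedPressure w) p volume ≤ C * eLpNorm (fun x => ‖w x‖ ^ 2) p volume

end Literature.Analysis.FluidPDE

end
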